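import Summits.AnomalousDissipation.AnomalousDissipation.Theses.TwoAndHalfD
import Literature.Analysis.FluidPDE.TwoHalfNavierStokes
import Literature.Analysis.FluidPDE.LongTimeAverageNonneg
import Literature.Analysis.FluidPDE.ReleaseLogBound

/-!
# Stub S4 `stub_releaseLogBound` of the line `log-kantorovich-enstrophy-transfer`

The logarithmic dissipation bound for releases at Sobolev level, in the DiPerna–Lions weak
class: a 3-line wrapper around `Literature.Analysis.FluidPDE.Torus.releaseLogBound`
(`Literature/Analysis/FluidPDE/ReleaseLogBound.lean`: two-point reversed-kernel argument for
smooth drifts, strain-controlled mollification, weak-* limit, DiPerna–Lions uniqueness for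
`L¹ₜḢ¹ₓ` drifts, weak lower semicontinuity of the dissipation).
-/

open MeasureTheory Filter Topology
open scoped ENNReal NNReal
open Literature.Analysis.FunctionSpaces Literature.Analysis.FluidPDE

set_option linter.dupNamespace false

namespace Summit.AnomalousDissipation.AnomalousDissipation.Theorems.TwohalfdNeg.ReleaseLogBound

/-- **The engine (S4): logarithmic dissipation bound for releases.** For every dimension, datum
bounds `|h| ≤ H`, `‖∇h‖ ≤ L` and window bound `T₀ > 0` there are `κ₀ ∈ (0,1)` and `C ≥ 0` such
that for `0 < κ ≤ κ₀`, `0 < T ≤ T₀`, every drift `u ∈ L^∞(0,T;L²)` with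
`∫₀ᵀ ‖∇u‖_{L²} ≤ S` and every weak solution `θ` of `∂ₜθ + u·∇θ = κΔθ`, `θ(0) = h`:
`κ∫₀ᵀ‖∇θ‖² ≤ C(S+1)/log(1/κ)`. [cite: Seis2022, Lemma 3 and Rmk. 1] -/
theorem stub_releaseLogBound :
    ∀ {d : Type} [Fintype d] [DecidableEq d] (H L T₀ : ℝ), 0 < T₀ →
      ∃ κ₀ C : ℝ, 0 < κ₀ ∧ κ₀ < 1 ∧ 0 ≤ C ∧
        ∀ (κ T S : ℝ) (u : ℝ → UnitAddTorus d → EuclideanSpace ℝ d) (h : UnitAddTorus d → ℝ)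
          (θ : ℝ → UnitAddTorus d → ℝ),
          0 < κ → κ ≤ κ₀ → 0 < T → T ≤ T₀ → 0 ≤ S →
          (∃ M : ℝ≥0, ∀ᵐ t ∂(volume.restrict (Set.Ioo 0 T)), ∫⁻ x, ‖u t x‖ₑ ^ 2 ≤ M) →
          ∫⁻ t in Set.Ioo 0 T, Torus.eGradNormSq (u t) ^ (1 / 2 : ℝ) ≤ ENNReal.ofReal S →
          Torus.IsSmooth h → (∀ x, |h x| ≤ H) → (∀ x, ‖Torus.gradient h x‖ ≤ L) →
          Torus.IsWeakScalarTransportOn T κ u h θ →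
          Torus.eScalarDissipation κ θ 0 T ≤ ENNReal.ofReal (C * (S + 1) / Real.log κ⁻¹) := by
  intro d _ _ H L T₀ hT₀
  exact Literature.Analysis.FluidPDE.Torus.releaseLogBound H L T₀ hT₀

end Summit.AnomalousDissipation.AnomalousDissipation.Theorems.TwohalfdNeg.ReleaseLogBound
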